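import Summits.BirchSwinnertonDyer.BirchSwinnertonDyer.Theorems.Rank2ShaSurjWitness
import Summits.BirchSwinnertonDyer.Rank1Residual.Additive.PlusSymbolIntegrality
import HarnessLib

/-!
# BirchSwinnertonDyer — rank-2 `Ш[p^∞]` cell: atlas-cell row theorems with the symbol INTEGRALITY binder
# discharged and the image hypothesis KERNEL-witnessed (referee R-013 F1/F2)

HONEST FRAMING (cell `b2b-bsdr2sha`, run/shared/lean/b2b/bsd-rank2-sha/): per-pair certified
theorems «cited hypotheses ∧ certified computation ⇒ `Ш(E/ℚ)[p^∞]` finite of order `p^k`» for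
rank-2 curves at good ordinary primes; NO claim on BSD in rank `≥ 2`, no class-level theorem, every
published input is a NAMED HYPOTHESIS of the tree (nothing is asserted or minted here).

Companion of `Rank2ShaRowKit.lean` (`AtlasCurve.shaRowSU` / `shaRowKato`). Two binders of those row
theorems are THEOREMS of the tree and are discharged here (cell referee R-013, findings F1/F2):

* F1 — the `p`-integrality of the plus modular symbols, `hint : ∀ x, ‖[x]⁺_f‖_p ≤ 1`: for `p` odd and
  `E[p]` irreducible this is the rank-`≤ 1` cell's theorem
  `Summit.BirchSwinnertonDyer.Rank1Residual.Additive.norm_ratPlusSymbol_le_one_of_irreducible`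
  (Manin–Drinfeld + the Eisenstein/Hecke operator `T_ℓ − ℓ − 1` at every cusp; printed counterpart
  Stein–Wuthrich 2013 Lemma 3.6, ms p. 9: the denominator of `[x]⁺` divides the exponent of the image of
  the cuspidal subgroup, prime to `p` when `ρ̄_{E,p}` is irreducible/surjective; Wuthrich 2014 p. 382).
  In frame «su-exact» `E[p]` irreducible is the row's kernel `SuWitness`; in frame «kato-bound» it follows
  from surjectivity (`hasIrreducibleModPGaloisRep_of_hasSurjectiveModNGaloisRep`).
* F2 — the image bit `Surj W p` of frame «kato-bound» is the row's kernel `SurjWitness`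
  (`Rank2ShaSurjWitness.lean`, Serre 1972 Prop. 19).

Hence `AtlasCurve.shaRowSU'` (su-exact; remaining hypotheses: named facts `hS`, `hSU`, newform `hf`,
rank certificate `hlow`, the symbol TABLE datum `htab` with its unit scalar `D`, THE canonical height `Dh`
with `hreg : ord_p Reg_p = b`) and `AtlasCurve.shaRowKatoK` (kato-bound; `hK` for `hSU`, a passing
`SurjWitness` for the (ram) witness; conclusion `ord_p #Ш ≤ k` and `#Ш = 1` if `k ≤ 0`). Per pair; NOT
class theorems.

References: W. Stein, C. Wuthrich, Math. Comp. 82 (2013), Lemma 3.6, Alg. 11.1 [SteinWuthrich2013];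
C. Wuthrich, Doc. Math. 19 (2014), p. 382 [Wuthrich2014]; C. Skinner, E. Urban, Invent. Math. 195 (2014),
Thm. 3.6.9 [SkinnerUrban2014]; K. Kato, Astérisque 295 (2004), Thm. 17.4 [Kato2004Asterisque];
J.-P. Serre, Invent. Math. 15 (1972), Prop. 19 [Serre1972]; J. Balakrishnan, J. S. Müller, W. Stein,
Math. Comp. 85 (2016), Thm. 1.7 [BalakrishnanMullerStein2015].
-/

set_option autoImplicit false

-- single-conjunct summit: `Summit.BirchSwinnertonDyer.BirchSwinnertonDyer.…` repeats the name by design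
set_option linter.dupNamespace false

noncomputable section

open scoped Classical MatrixGroups ModularForm

open CongruenceSubgroup WeierstrassCurve Literature.NumberTheory.EllipticCurves
  Literature.NumberTheory.EllipticCurves.ModularForms
  Literature.NumberTheory.EllipticCurves.Rank1Residual
  Summit.BirchSwinnertonDyer.BirchSwinnertonDyer.Rank2Observatory

open Summit.BirchSwinnertonDyer.Rank1Residual.Additive (norm_ratPlusSymbol_le_one_of_irreducible)

namespace Summit.BirchSwinnertonDyer.BirchSwinnertonDyer.Rank2Sha

/-- **ROW THEOREM on an atlas cell, frame «su-exact», integrality binder DISCHARGED.** As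
`AtlasCurve.shaRowSU` without `hint`: the `p`-integrality of every plus symbol of `f` is the tree theorem
`norm_ratPlusSymbol_le_one_of_irreducible` (`p` odd, `E[p]` irreducible — the latter from the row's
`SuWitness`). Remaining hypotheses: `hS`, `hSU`, the newform `hf`, `hlow`, the symbol-table datum `htab`
(with `‖D‖_p = 1`), THE canonical height `Dh` and `hreg`. Conclusion: `rank = 2`, `Ш(E/ℚ)[p^∞]` finite,
`Reg_p ≠ 0`, `#Ш(E/ℚ)[p^∞] = p^k`, `k = ord_p(A·H − L) + 2 − 2·ord_p #Ẽ(𝔽_p) − ord_p ∏c_ℓ − b`. Per pair; NOT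
a class theorem. [cite: SteinWuthrich2013, Lemma 3.6 and Alg. 11.1] [cite: SkinnerUrban2014, Thm. 3.6.9 (p. 45)]
[cite: BalakrishnanMullerStein2015, Thm. 1.7] -/
theorem AtlasCurve.shaRowSU' {C : AtlasCurve} (h : C.check = true) {c : AtlasCell} (hc : c ∈ C.cells)
    [Fact c.p.Prime] [(C.e.baseChange ℚ).IsElliptic] [(C.e.baseChange ℚ).IsGloballyMinimal]
    {w : SuWitness} (hw : w.check C.e c.p = true)
    {Es : List Tam.TamLocal} (hEs : Tam.TamLocal.rowCheck Es C.e = true)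
    (hEx : Tam.TamLocal.rowExact Es = true)
    (hS : Schneider1985_order_charGenerator_odd) {N : ℕ} [NeZero N] {f : CuspForm (Gamma0 N) 2}
    (hf : IsNewformOf (C.e.baseChange ℚ) f)
    (hSU : ∀ (κ : ZpExtension ℚ c.p) (γ : Field.absoluteGaloisGroup ℚ),
      skinner_urban_main_conjecture (C.e.baseChange ℚ) c.p (κ := κ) (γ := γ) (f := f))
    (hlow : 2 ≤ C.row.curve.mordellWeilRank) (D : ℚ) (hD : ‖(D : ℚ_[c.p])‖ = 1)
    (htab : ∀ u : ℕ, u < c.p ^ (c.n + 1) → ¬ c.p ∣ u →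
      ratPlusSymbol f ((u : ℚ) / (c.p : ℚ) ^ (c.n + 1)) = (c.tabHi.getD u 0 : ℚ) / D ∧
      ratPlusSymbol f ((u : ℚ) / (c.p : ℚ) ^ c.n) = (c.tabLo.getD (u % c.p ^ c.n) 0 : ℚ) / D)
    (Dh : PAdicHeightData (C.e.baseChange ℚ) c.p) (hDh : Dh.IsCanonical) {b : ℤ}
    (hreg : (padicRegulator Dh).valuation = b) :
    C.row.curve.mordellWeilRank = 2 ∧
      Finite (AddCommGroup.primaryComponent (C.e.baseChange ℚ).sha c.p) ∧ SchneiderConjecture Dh ∧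
      ∃ k : ℕ, Nat.card (AddCommGroup.primaryComponent (C.e.baseChange ℚ).sha c.p) = c.p ^ k ∧
        (k : ℤ) = padicValInt c.p (c.A * c.H - c.L) + 2 - 2 * padicValNat c.p (c.count C.e) -
          padicValNat c.p (Tam.TamLocal.rowValue Es) - b := by
  have hk : c.check C.e = true := AtlasCurve.cell_check h hc
  have hp2 : c.p ≠ 2 := by have := AtlasCell.five_le_of_check hk; omega
  have hirr : (C.e.baseChange ℚ).HasIrreducibleModPGaloisRep c.p :=
    SuWitness.irr_of_check hw _ AtlasCurve.integralModelInt_eq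
  exact AtlasCurve.shaRowSU h hc hw hEs hEx hS hf hSU hlow D hD
    (fun x => norm_ratPlusSymbol_le_one_of_irreducible hp2 hf hirr x) htab Dh hDh hreg

/-- **ROW THEOREM on an atlas cell, frame «kato-bound», integrality AND image binder DISCHARGED.** As
`AtlasCurve.shaRowKato` / `shaRowKato_eq_one` without `hint` and without `hsurj`: `ρ̄_{E,p}` surjective is
the row's kernel Serre witness (`SurjWitness.surj_of_check`), irreducibility follows, and the symbol
integrality is the tree theorem. Remaining hypotheses: `hS`, `hK` (Kato Thm. 17.4, every cyclotomic
datum), the newform `hf`, `hlow`, `htab`/`D`, `Dh` canonical with `hreg`. Conclusion: `rank = 2`,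
`Ш(E/ℚ)[p^∞]` finite, `Reg_p ≠ 0`, `ord_p #Ш ≤ k` with `k` as in `shaRowSU'`, and `#Ш(E/ℚ)[p^∞] = 1` if
`k ≤ 0`. Per pair; NOT a class theorem. [cite: Kato2004Asterisque, Thm. 17.4 (3) (p. 273)]
[cite: Serre1972, §2.8 Prop. 19] [cite: SteinWuthrich2013, Lemma 3.6 and Alg. 11.1]
[cite: BalakrishnanMullerStein2015, Thm. 1.7] -/
theorem AtlasCurve.shaRowKatoK {C : AtlasCurve} (h : C.check = true) {c : AtlasCell} (hc : c ∈ C.cells)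
    [Fact c.p.Prime] [(C.e.baseChange ℚ).IsElliptic] [(C.e.baseChange ℚ).IsGloballyMinimal]
    {s : SurjWitness} (hs : s.check C.e c.p = true)
    {Es : List Tam.TamLocal} (hEs : Tam.TamLocal.rowCheck Es C.e = true)
    (hEx : Tam.TamLocal.rowExact Es = true)
    (hS : Schneider1985_order_charGenerator_odd) {N : ℕ} [NeZero N] {f : CuspForm (Gamma0 N) 2}
    (hf : IsNewformOf (C.e.baseChange ℚ) f)
    (hK : ∀ (κ : ZpExtension ℚ c.p) (γ : Field.absoluteGaloisGroup ℚ),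
      kato_divisibility (C.e.baseChange ℚ) c.p (κ := κ) (γ := γ) (f := f))
    (hlow : 2 ≤ C.row.curve.mordellWeilRank) (D : ℚ) (hD : ‖(D : ℚ_[c.p])‖ = 1)
    (htab : ∀ u : ℕ, u < c.p ^ (c.n + 1) → ¬ c.p ∣ u →
      ratPlusSymbol f ((u : ℚ) / (c.p : ℚ) ^ (c.n + 1)) = (c.tabHi.getD u 0 : ℚ) / D ∧
      ratPlusSymbol f ((u : ℚ) / (c.p : ℚ) ^ c.n) = (c.tabLo.getD (u % c.p ^ c.n) 0 : ℚ) / D)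
    (Dh : PAdicHeightData (C.e.baseChange ℚ) c.p) (hDh : Dh.IsCanonical) {b : ℤ}
    (hreg : (padicRegulator Dh).valuation = b) :
    C.row.curve.mordellWeilRank = 2 ∧
      Finite (AddCommGroup.primaryComponent (C.e.baseChange ℚ).sha c.p) ∧ SchneiderConjecture Dh ∧
      (padicValNat c.p (Nat.card (AddCommGroup.primaryComponent (C.e.baseChange ℚ).sha c.p)) : ℤ) ≤
        padicValInt c.p (c.A * c.H - c.L) + 2 - 2 * padicValNat c.p (c.count C.e) -
          padicValNat c.p (Tam.TamLocal.rowValue Es) - b ∧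
      (padicValInt c.p (c.A * c.H - c.L) + 2 - 2 * padicValNat c.p (c.count C.e) -
          padicValNat c.p (Tam.TamLocal.rowValue Es) - b ≤ 0 →
        Nat.card (AddCommGroup.primaryComponent (C.e.baseChange ℚ).sha c.p) = 1) := by
  have hk : c.check C.e = true := AtlasCurve.cell_check h hc
  have hp2 : c.p ≠ 2 := by have := AtlasCell.five_le_of_check hk; omega
  haveI : NeZero (c.p : ℚ) := ⟨Nat.cast_ne_zero.mpr (Fact.out : c.p.Prime).ne_zero⟩
  have hsurj : (C.e.baseChange ℚ).HasSurjectiveModNGaloisRep c.p :=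
    SurjWitness.surj_of_check hs _ AtlasCurve.integralModelInt_eq
  have hirr : (C.e.baseChange ℚ).HasIrreducibleModPGaloisRep c.p :=
    hasIrreducibleModPGaloisRep_of_hasSurjectiveModNGaloisRep _ c.p hsurj
  have hint : ∀ x : ℚ, ‖(ratPlusSymbol f x : ℚ_[c.p])‖ ≤ 1 :=
    fun x => norm_ratPlusSymbol_le_one_of_irreducible hp2 hf hirr x
  obtain ⟨hr, hfin, hSch, hle⟩ := AtlasCurve.shaRowKato h hc hEs hEx hS hf hK hsurj hlow D hD hint htab
    Dh hDh hreg
  exact ⟨hr, hfin, hSch, hle, fun hk0 =>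
    (AtlasCurve.shaRowKato_eq_one h hc hEs hEx hS hf hK hsurj hlow D hD hint htab Dh hDh hreg hk0).2.2.2⟩

end Summit.BirchSwinnertonDyer.BirchSwinnertonDyer.Rank2Sha

end
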